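import Summits.AtomisticToContinuum.Crystallization.Theorems.FrustratedLawDichotomyCellTailsRem
import Summits.AtomisticToContinuum.Crystallization.Theorems.FrustratedLawDichotomyCellClasses

/-!
# FrustratedLawDichotomy · crux `AperiodicFrustratedLawGap` (stmt-AtomisticToContinuum-27623) — CELL-ARITH companion: THE FORCE-REMAINDER COLUMN
# REDUCED TO THE INTERIOR (decomp-a2c hand-1 g54; for the (251) master under LABELS-SCALE, crit r1809)

The `hRM` hypothesis of (251) `…CellTailsRem.lb_le_certFloorL_trunc` is a double sum over ALL template labels `m ∈ M` (outer) and the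
near-pair lists `(M.erase m).filter (· ∈ nbr m)` (inner) of `‖YE m − YE m'‖·forceRem ‖pos m − pos m'‖ (dispL m + dispL m')`.  Under
the LABELS-SCALE mechanics of record (list-backed `M` of ≈ 14 000 labels whose `Finset` is never evaluated) that sum cannot be folded as
stated.  But `YE` vanishes off the interior `MI`, so only INTERIOR-ADJACENT pairs contribute:

* §1 (any symmetric weight `w`, any lists `nbr`): `inner_interior` / `inner_exterior` — the inner sum at an interior / exterior label;
  `exterior_block` — the exterior outer block re-indexed by the interior (exchange of sums + SYMMETRY of the lists and of `w`);
  ★ `rm_double_sum_eq` —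
  `ΣΣ_M ‖YE m − YE m'‖·w = Σ_{x∈MI} Σ_{x'∈(MI∖x) ∩ nbr x} ‖Y x − Y x'‖·w + 2·Σ_{x∈MI} Σ_{m'∈(M∖MI) ∩ nbr x} ‖Y x‖·w`.
* §2 (the (251) weight): ★★ `hRM_of_interior` — the `hRM` hypothesis VERBATIM from per-interior-label numbers `rI x`, `rO x` certified
  over ANY SUPERSET lists `SI x ⊇ (MI.erase x).filter (· ∈ nbr x)`, `SO x ⊇ (M ∖ MI).filter (· ∈ nbr x)` (inclusions = predicate facts;
  all terms are `≥ 0` by (hand-1) `forceRem_nonneg`): `½ΣΣ_M … ≤ ½Σ_{x∈MI} rI x + Σ_{x∈MI} rO x`.  Entries by (hand-1 g53) `rmTerm_le` /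
  `rmTerm_le'` with the `‖Y x − Y x'‖` / `‖Y x‖` witnesses of `…CellArithWitness` (TOY ROW 4Z pattern) — the RM file of a K-file touches
  `MI × ℓ_r`-lists only.
* §3 `mem_ballL_comm` — the (261) integer-radius lists `ballL M z ℓ` are symmetric (the `hsym` hypothesis for `nbr := ballL M z ℓ`);
  `rmWeight_symm` — the (251) weight is symmetric.
DEF-FREE; imports TREE (251) `…CellTailsRem` and (261) `…CellClasses`; 0 sorry.  All `[folklore]`.
-/

noncomputable section

namespace Summit.AtomisticToContinuum.Crystallization.Theorems.FrustratedLawDichotomyCellRemInterior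

open Metric Set
open scoped BigOperators
open Summit.AtomisticToContinuum.Crystallization.Theorems.ChargedEnergyGapNegative (E3)
open Summit.AtomisticToContinuum.Crystallization.Theorems.FrustratedLawDichotomyCoherentFloorAlgebra (forceRem)
open Summit.AtomisticToContinuum.Crystallization.Theorems.FrustratedLawDichotomyCertFloorTailsRem (forceRem_nonneg)
open Summit.AtomisticToContinuum.Crystallization.Theorems.FrustratedLawDichotomyCellFrame (YE dispL)
open Summit.AtomisticToContinuum.Crystallization.Theorems.FrustratedLawDichotomyCellTailsRem (dispL_add_mem)
open Summit.AtomisticToContinuum.Crystallization.Theorems.FrustratedLawDichotomyCellClasses (ballL)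

variable {ι : Type*} [DecidableEq ι]

/-! ## §1. Generic symmetric weight: the double sum lives on interior-adjacent pairs -/

section Generic

variable {M MI : Finset ι} {Y : ι → E3} {nbr : ι → Finset ι} {w : ι → ι → ℝ}

/-- `YE` on the interior. [folklore] -/
theorem YE_of_mem {x : ι} (hx : x ∈ MI) : YE MI Y x = Y x := by simp [YE, hx]

/-- `YE` off the interior. [folklore] -/
theorem YE_of_not_mem {m : ι} (hm : m ∉ MI) : YE MI Y m = 0 := by simp [YE, hm]

/-- the interior part of an interior label's near list. [folklore] -/
theorem filter_mem_interior (hMI : MI ⊆ M) {x : ι} :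
    ((M.erase x).filter (fun m' => m' ∈ nbr x)).filter (fun m' => m' ∈ MI) = (MI.erase x).filter (fun m' => m' ∈ nbr x) := by
  ext m'
  simp only [Finset.mem_filter, Finset.mem_erase]
  constructor
  · rintro ⟨⟨⟨hne, _⟩, hn⟩, hI⟩; exact ⟨⟨hne, hI⟩, hn⟩
  · rintro ⟨⟨hne, hI⟩, hn⟩; exact ⟨⟨⟨hne, hMI hI⟩, hn⟩, hI⟩

/-- the exterior part of an interior label's near list. [folklore] -/
theorem filter_not_mem_interior {x : ι} (hx : x ∈ MI) :
    ((M.erase x).filter (fun m' => m' ∈ nbr x)).filter (fun m' => m' ∉ MI) = (M \ MI).filter (fun m' => m' ∈ nbr x) := by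
  ext m'
  simp only [Finset.mem_filter, Finset.mem_erase, Finset.mem_sdiff]
  constructor
  · rintro ⟨⟨⟨_, hM⟩, hn⟩, hI⟩; exact ⟨⟨hM, hI⟩, hn⟩
  · rintro ⟨⟨hM, hI⟩, hn⟩
    exact ⟨⟨⟨fun h => hI (h ▸ hx), hM⟩, hn⟩, hI⟩

/-- the interior part of an exterior label's near list. [folklore] -/
theorem filter_mem_exterior (hMI : MI ⊆ M) {m : ι} (hm : m ∉ MI) :
    ((M.erase m).filter (fun m' => m' ∈ nbr m)).filter (fun m' => m' ∈ MI) = MI.filter (fun m' => m' ∈ nbr m) := by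
  ext m'
  simp only [Finset.mem_filter, Finset.mem_erase]
  constructor
  · rintro ⟨⟨⟨_, _⟩, hn⟩, hI⟩; exact ⟨hI, hn⟩
  · rintro ⟨hI, hn⟩
    exact ⟨⟨⟨fun h => hm (h ▸ hI), hMI hI⟩, hn⟩, hI⟩

/-- ★ THE INNER SUM AT AN INTERIOR LABEL `x`: interior partners carry `‖Y x − Y x'‖`, exterior partners carry `‖Y x‖`. [folklore] -/
theorem inner_interior (hMI : MI ⊆ M) {x : ι} (hx : x ∈ MI) :
    ∑ m' ∈ (M.erase x).filter (fun m' => m' ∈ nbr x), ‖YE MI Y x - YE MI Y m'‖ * w x m'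
      = ∑ x' ∈ (MI.erase x).filter (fun m' => m' ∈ nbr x), ‖Y x - Y x'‖ * w x x'
        + ∑ m' ∈ (M \ MI).filter (fun m' => m' ∈ nbr x), ‖Y x‖ * w x m' := by
  rw [← Finset.sum_filter_add_sum_filter_not _ (fun m' => m' ∈ MI), filter_mem_interior hMI, filter_not_mem_interior hx]
  congr 1
  · refine Finset.sum_congr rfl fun x' hx' => ?_
    have hI : x' ∈ MI := Finset.mem_of_mem_erase (Finset.mem_filter.mp hx').1
    rw [YE_of_mem hx, YE_of_mem hI]
  · refine Finset.sum_congr rfl fun m' hm' => ?_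
    have hI : m' ∉ MI := (Finset.mem_sdiff.mp (Finset.mem_filter.mp hm').1).2
    rw [YE_of_mem hx, YE_of_not_mem hI, sub_zero]

/-- ★ THE INNER SUM AT AN EXTERIOR LABEL `m`: only interior partners contribute, with `‖Y x‖`. [folklore] -/
theorem inner_exterior (hMI : MI ⊆ M) {m : ι} (hm : m ∉ MI) :
    ∑ m' ∈ (M.erase m).filter (fun m' => m' ∈ nbr m), ‖YE MI Y m - YE MI Y m'‖ * w m m'
      = ∑ x ∈ MI.filter (fun m' => m' ∈ nbr m), ‖Y x‖ * w m x := by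
  rw [← Finset.sum_filter_add_sum_filter_not _ (fun m' => m' ∈ MI), filter_mem_exterior hMI hm]
  have h0 : ∑ m' ∈ ((M.erase m).filter (fun m' => m' ∈ nbr m)).filter (fun m' => m' ∉ MI),
      ‖YE MI Y m - YE MI Y m'‖ * w m m' = 0 := by
    refine Finset.sum_eq_zero fun m' hm' => ?_
    have hI : m' ∉ MI := (Finset.mem_filter.mp hm').2
    rw [YE_of_not_mem hm, YE_of_not_mem hI, sub_zero, norm_zero, zero_mul]
  rw [h0, add_zero]
  refine Finset.sum_congr rfl fun x hx => ?_
  have hI : x ∈ MI := (Finset.mem_filter.mp hx).1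
  rw [YE_of_not_mem hm, YE_of_mem hI, zero_sub, norm_neg]

/-- ★ THE EXTERIOR BLOCK RE-INDEXED BY THE INTERIOR: exchange of the two sums, then symmetry of the lists (`m' ∈ nbr m ↔ m ∈ nbr m'` on `M`)
and of the weight. [folklore] -/
theorem exterior_block (hMI : MI ⊆ M) (hsym : ∀ m ∈ M, ∀ m' ∈ M, m' ∈ nbr m → m ∈ nbr m') (hw : ∀ m m', w m m' = w m' m) :
    ∑ m ∈ M \ MI, ∑ x ∈ MI.filter (fun m' => m' ∈ nbr m), ‖Y x‖ * w m x
      = ∑ x ∈ MI, ∑ m' ∈ (M \ MI).filter (fun m' => m' ∈ nbr x), ‖Y x‖ * w x m' := by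
  rw [Finset.sum_comm' (t' := MI) (s' := fun x => (M \ MI).filter (fun m => x ∈ nbr m)) (h := fun m x => by
    simp only [Finset.mem_filter, Finset.mem_sdiff]; tauto)]
  refine Finset.sum_congr rfl fun x hx => ?_
  have hxM : x ∈ M := hMI hx
  rw [Finset.filter_congr (q := fun m => m ∈ nbr x) (fun m hm => ?_)]
  · exact Finset.sum_congr rfl fun m _ => by rw [hw]
  · have hmM : m ∈ M := (Finset.mem_sdiff.mp hm).1
    exact ⟨fun h => hsym m hmM x hxM h, fun h => hsym x hxM m hmM h⟩

/-- ★★ THE DOUBLE SUM ON INTERIOR-ADJACENT PAIRS (identity): for `MI ⊆ M`, symmetric lists on `M` and a symmetric weight,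
`ΣΣ_{m∈M, m'∈(M∖m)∩nbr m} ‖YE m − YE m'‖·w m m'
  = Σ_{x∈MI} Σ_{x'∈(MI∖x)∩nbr x} ‖Y x − Y x'‖·w x x' + 2·Σ_{x∈MI} Σ_{m'∈(M∖MI)∩nbr x} ‖Y x‖·w x m'`. [folklore] -/
theorem rm_double_sum_eq (hMI : MI ⊆ M) (hsym : ∀ m ∈ M, ∀ m' ∈ M, m' ∈ nbr m → m ∈ nbr m') (hw : ∀ m m', w m m' = w m' m) :
    ∑ m ∈ M, ∑ m' ∈ (M.erase m).filter (fun m' => m' ∈ nbr m), ‖YE MI Y m - YE MI Y m'‖ * w m m'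
      = ∑ x ∈ MI, ∑ x' ∈ (MI.erase x).filter (fun m' => m' ∈ nbr x), ‖Y x - Y x'‖ * w x x'
        + 2 * ∑ x ∈ MI, ∑ m' ∈ (M \ MI).filter (fun m' => m' ∈ nbr x), ‖Y x‖ * w x m' := by
  rw [← Finset.sum_sdiff hMI]
  have hE : ∑ m ∈ M \ MI, ∑ m' ∈ (M.erase m).filter (fun m' => m' ∈ nbr m), ‖YE MI Y m - YE MI Y m'‖ * w m m'
      = ∑ x ∈ MI, ∑ m' ∈ (M \ MI).filter (fun m' => m' ∈ nbr x), ‖Y x‖ * w x m' := by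
    rw [← exterior_block hMI hsym hw]
    exact Finset.sum_congr rfl fun m hm => inner_exterior hMI (Finset.mem_sdiff.mp hm).2
  have hI : ∑ x ∈ MI, ∑ m' ∈ (M.erase x).filter (fun m' => m' ∈ nbr x), ‖YE MI Y x - YE MI Y m'‖ * w x m'
      = ∑ x ∈ MI, ∑ x' ∈ (MI.erase x).filter (fun m' => m' ∈ nbr x), ‖Y x - Y x'‖ * w x x'
        + ∑ x ∈ MI, ∑ m' ∈ (M \ MI).filter (fun m' => m' ∈ nbr x), ‖Y x‖ * w x m' := by
    rw [← Finset.sum_add_distrib]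
    exact Finset.sum_congr rfl fun x hx => inner_interior hMI hx
  rw [hE, hI]
  ring

end Generic

/-! ## §2. The (251) weight: `hRM` from interior lists -/

section Master

variable {M MI : Finset ι} {pos Y : ι → E3} {nbr : ι → Finset ι}

/-- the (251) remainder weight is symmetric. [folklore] -/
theorem rmWeight_symm (o : ι) (τ : ℝ) (m m' : ι) :
    forceRem ‖pos m - pos m'‖ (dispL o τ m + dispL o τ m') = forceRem ‖pos m' - pos m‖ (dispL o τ m' + dispL o τ m) := by
  rw [norm_sub_rev, add_comm]

/-- the (251) remainder weight is nonnegative (`0 ≤ τ`). [folklore] -/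
theorem rmWeight_nonneg (o : ι) {τ : ℝ} (hτ0 : 0 ≤ τ) (m m' : ι) :
    0 ≤ forceRem ‖pos m - pos m'‖ (dispL o τ m + dispL o τ m') :=
  forceRem_nonneg (norm_nonneg _) (dispL_add_mem o hτ0 m m').1

/-- ★★ **THE `hRM` HYPOTHESIS OF (251) FROM INTERIOR LISTS.**  `MI ⊆ M`, lists symmetric on `M` (e.g. `ballL`, §3), `0 ≤ τ`; for every
interior label `x` ANY finite superset `SI x` of its interior near partners and `SO x` of its exterior near partners, with certified numbers
`Σ_{SI x} ‖Y x − Y x'‖·w ≤ rI x` and `Σ_{SO x} ‖Y x‖·w ≤ rO x` (`w` = the (251) weight).  Then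
`½ΣΣ_{m∈M, m'∈(M∖m)∩nbr m} ‖YE m − YE m'‖·w ≤ ½Σ_{x∈MI} rI x + Σ_{x∈MI} rO x` — an `RM` the K-file may feed to the master. [folklore] -/
theorem hRM_of_interior (o : ι) {τ : ℝ} (hτ0 : 0 ≤ τ) (hMI : MI ⊆ M)
    (hsym : ∀ m ∈ M, ∀ m' ∈ M, m' ∈ nbr m → m ∈ nbr m') (SI SO : ι → Finset ι)
    (hSI : ∀ x ∈ MI, (MI.erase x).filter (fun m' => m' ∈ nbr x) ⊆ SI x)
    (hSO : ∀ x ∈ MI, (M \ MI).filter (fun m' => m' ∈ nbr x) ⊆ SO x) (rI rO : ι → ℝ)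
    (hI : ∀ x ∈ MI, ∑ x' ∈ SI x, ‖Y x - Y x'‖ * forceRem ‖pos x - pos x'‖ (dispL o τ x + dispL o τ x') ≤ rI x)
    (hO : ∀ x ∈ MI, ∑ m' ∈ SO x, ‖Y x‖ * forceRem ‖pos x - pos m'‖ (dispL o τ x + dispL o τ m') ≤ rO x) :
    1 / 2 * ∑ m ∈ M, ∑ m' ∈ (M.erase m).filter (fun m' => m' ∈ nbr m),
        ‖YE MI Y m - YE MI Y m'‖ * forceRem ‖pos m - pos m'‖ (dispL o τ m + dispL o τ m')
      ≤ 1 / 2 * ∑ x ∈ MI, rI x + ∑ x ∈ MI, rO x := by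
  rw [rm_double_sum_eq (w := fun m m' => forceRem ‖pos m - pos m'‖ (dispL o τ m + dispL o τ m')) hMI hsym (rmWeight_symm o τ)]
  have h1 : ∑ x ∈ MI, ∑ x' ∈ (MI.erase x).filter (fun m' => m' ∈ nbr x),
      ‖Y x - Y x'‖ * forceRem ‖pos x - pos x'‖ (dispL o τ x + dispL o τ x') ≤ ∑ x ∈ MI, rI x := by
    refine Finset.sum_le_sum fun x hx => le_trans ?_ (hI x hx)
    exact Finset.sum_le_sum_of_subset_of_nonneg (hSI x hx) fun x' _ _ =>
      mul_nonneg (norm_nonneg _) (rmWeight_nonneg o hτ0 x x')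
  have h2 : ∑ x ∈ MI, ∑ m' ∈ (M \ MI).filter (fun m' => m' ∈ nbr x),
      ‖Y x‖ * forceRem ‖pos x - pos m'‖ (dispL o τ x + dispL o τ m') ≤ ∑ x ∈ MI, rO x := by
    refine Finset.sum_le_sum fun x hx => le_trans ?_ (hO x hx)
    exact Finset.sum_le_sum_of_subset_of_nonneg (hSO x hx) fun m' _ _ =>
      mul_nonneg (norm_nonneg _) (rmWeight_nonneg o hτ0 x m')
  linarith

/-- the EXACT interior form when the lists themselves are used (`SI`, `SO` := the near sets): `RM` may be taken as
`½Σ_{x∈MI} rI x + Σ_{x∈MI} rO x` with equality in the double sum. [folklore] -/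
theorem half_rm_double_sum_eq (o : ι) (τ : ℝ) (hMI : MI ⊆ M) (hsym : ∀ m ∈ M, ∀ m' ∈ M, m' ∈ nbr m → m ∈ nbr m') :
    1 / 2 * ∑ m ∈ M, ∑ m' ∈ (M.erase m).filter (fun m' => m' ∈ nbr m),
        ‖YE MI Y m - YE MI Y m'‖ * forceRem ‖pos m - pos m'‖ (dispL o τ m + dispL o τ m')
      = 1 / 2 * ∑ x ∈ MI, ∑ x' ∈ (MI.erase x).filter (fun m' => m' ∈ nbr x),
            ‖Y x - Y x'‖ * forceRem ‖pos x - pos x'‖ (dispL o τ x + dispL o τ x')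
        + ∑ x ∈ MI, ∑ m' ∈ (M \ MI).filter (fun m' => m' ∈ nbr x),
            ‖Y x‖ * forceRem ‖pos x - pos m'‖ (dispL o τ x + dispL o τ m') := by
  rw [rm_double_sum_eq (w := fun m m' => forceRem ‖pos m - pos m'‖ (dispL o τ m + dispL o τ m')) hMI hsym (rmWeight_symm o τ)]
  ring

end Master

/-! ## §3. The (261) integer-radius lists are symmetric -/

omit [DecidableEq ι] in
/-- ★ `ballL` is symmetric on `M`: the `hsym` hypothesis of §1–§2 for `nbr := ballL M z ℓ`. [folklore] -/
theorem mem_ballL_comm {M : Finset ι} {z : ι → Fin 3 → ℤ} {ℓ : ℤ} {x c : ι} (hx : x ∈ M) (hc : c ∈ M) :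
    x ∈ ballL M z ℓ c ↔ c ∈ ballL M z ℓ x := by
  have e : ∑ i, (z x i - z c i) ^ 2 = ∑ i, (z c i - z x i) ^ 2 := Finset.sum_congr rfl fun i _ => by ring
  simp only [ballL, Finset.mem_filter, hx, hc, true_and, e]

omit [DecidableEq ι] in
/-- `hsym` for `nbr := ballL M z ℓ`, in the shape §2 consumes. [folklore] -/
theorem ballL_hsym (M : Finset ι) (z : ι → Fin 3 → ℤ) (ℓ : ℤ) :
    ∀ m ∈ M, ∀ m' ∈ M, m' ∈ ballL M z ℓ m → m ∈ ballL M z ℓ m' :=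
  fun _ hm _ hm' h => (mem_ballL_comm hm' hm).mp h

end Summit.AtomisticToContinuum.Crystallization.Theorems.FrustratedLawDichotomyCellRemInterior

end
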